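import Summits.BirchSwinnertonDyer.Rank1Residual.Additive.SelmerStructureLayerZeroBridge
import Summits.BirchSwinnertonDyer.Rank1Residual.Additive.LocalTrivialityUpTower
import HarnessLib

/-!
# THE BRIDGE for the (C3_η) objects: `A₀ = Sel^{loc,∞}`, `S₀ = Sel^{−,str}(E/K_0)` ARE (along `Ψ_m`)
# Selmer groups of explicit Selmer structures on `E[p^m]`, and **`[A₀ : S₀] = [H¹_𝓖 : H¹_{𝓚[v₀ ↦ 0]}]`**
# — the vocabulary BRIDGE, part 4 (cell `b2b-bsdres`, class O10 — x1b GEN 38; file 74 of the series)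

HONEST FRAMING (cell `b2b-bsdres`, run/shared/lean/b2b/bsd-rank1-residual/, verbatim in every
file): the goal of the cell is to DELETE the COMBINATION-SHAPED residual classes of the
Birch–Swinnerton-Dyer formula for ALL analytic-rank `≤ 1` elliptic curves over `ℚ` — "full BSD
formula for every rank `≤ 1` curve in class `C`" assembled STRICTLY from published theorems — so
that the rank-`≤ 1` remainder becomes exactly the CONSTRUCTION-SHAPED classes, which are TYPED
(missing-input `Prop`s), NOT attempted. This is not "finishing BSD". CLASS-CLOSURE lane: prove
what is provable now; shrink each hard class to its core with data; no claim beyond stated classes;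
research routes on CONSTRUCTION-SHAPED X12 / O10; census / instrument output = EVIDENCE / conjecture
items, NEVER a Literature fact; `RESIDUAL-MAP.md` marks change only by signed lines. THIS FILE:
TOOL THEOREMS ONLY — no definition, no named Literature fact, no Summits-side fact `def … : Prop`,
no `sorry`, axioms standard; Galois-cohomology bookkeeping over ANY number field `K`, any prime `p`,
any `ℤ_p`-extension `κ`, any level `p^m`, any model `E` of the completion at `v₀` linked to
`K_{v₀} = v₀.adicCompletion K` by `K`-algebra maps BOTH WAYS (for `K = ℚ`, `E = ℚ_[p]`: Mathlib's
`padicEquiv`); nothing is booked; no label / mark / count / sub-cell moves; (C1_η), (C2_η-GZ), (C3_η)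
stay typed as filed (cc-typer-6's pen); O10 stays OPEN / CONSTRUCTION-SHAPED; nothing about
`BSD(W, p)` of any pair is claimed.

## What (all kernel theorems; `Ψ_m`, `θ_v`, the tower structure `𝓣` as in files 71–73)

* §1 `S₀`: **`Ψ_m c ∈ Sel^{−,str}(E/K_0) ↔ c ∈ H¹_{𝓚[v₀ ↦ 0]}(K, E[p^m])`** (Kummer everywhere, ZERO at
  `v₀`) when `E(Ē)[p^∞]^{Γ_E} = 0`: the level-`0` strict-minus local group is the TORSION of `E(E)`,
  its Kummer condition is triviality in `H¹(E, E(Ē)[p^∞])` (n1011/p17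
  `StrictSignedLayerZero.resH1Hom_subgroupIncl_mem_localKummerOverOfEmb_iff`), which for `Ψ_m c` is
  `res_E c = 0` (`E[p^k](K̄) ≅ E(Ē)[p^k]`, X11b `map_primaryInclusion_restrictField_injective`)
  `↔ loc_{v₀} c = 0` (file 73); and `Ψ_m c ∈ Sel_{p^∞}(E/K_0) ↔ c ∈ H¹_𝓚` (file 71).
* §2 `A₀`: **`Ψ_m c ∈ A₀ ↔ c ∈ H¹_{𝓣[v₀ ↦ 𝓣_{v₀} ⊓ L]}`**, `A₀ = (Sel_{p^∞}(E/K_∞) ⊓ ⨅_σ conj_σ⁻¹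
  Kummer_∞(A)) ∘ h_0` (files 42–59; ANY `A ≤ E(Ē)`), `L = loc_{v₀}(Ψ_m⁻¹ A₀)` — the signed condition
  IS LOCAL AT `v₀` (file 73 §4: a class with `loc_{v₀} = 0` satisfies every Kummer condition at `E`).
* §3 **`[H¹_{𝓣[v₀ ↦ 𝓣_{v₀} ⊓ L]} : H¹_{𝓚[v₀ ↦ 0]}] = [A₀ : S₀]`** once `p^m A₀ = 0` (file 72 index
  transfer) — the count (C) at finite level (files 63, 68–70) computes the left side.

References: [GreenbergLNM1716] §3; [Kobayashi2003] §2, Def. 2.1, §9; [Skinner2020] §2.2.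
-/

noncomputable section

open scoped Classical

open WeierstrassCurve Literature.NumberTheory.EllipticCurves Literature.NumberTheory.GaloisRepresentations
  NumberField IsDedekindDomain Field
open Literature.NumberTheory.GaloisRepresentations.DiscreteGaloisModule (SelmerStructure)
open Literature.NumberTheory.EllipticCurves.Kobayashi2003
open Summit.BirchSwinnertonDyer.Rank1Residual.X11b.Levels
open Summit.BirchSwinnertonDyer.Rank1Residual.X11b
open scoped ContRepresentation

namespace Summit.BirchSwinnertonDyer.Rank1Residual.Additive.LevelBridge

universe u

section Classical

variable {K : Type u} [Field K] [NumberField K] (W : WeierstrassCurve K) (p : ℕ) [hp : Fact p.Prime]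
  (κ : ZpExtension K p) (m : ℕ)

/-- **`Ψ_m c ∈ Sel_{p^∞}(E/K_0) ↔ c ∈ H¹_𝓚(K, E[p^m]) = Sel^{(p^m)}(E/K)`**: the classical Selmer
condition at every place of `K_0 = K` (conjugations act trivially on `H¹(κ⁻¹(p⁰ℤ_p), ·)`,
`conjH1_of_mem_holds`) is `θ_v (loc_v c) = 0`, i.e. the Kummer condition `loc_v c ∈ 𝓚_v` (file 71).
[cite: GreenbergLNM1716, §2 (Sel_E(F)_p) and §3 p. 85] -/
theorem levelToLayerZero_mem_selmerLayer_zero_iff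
    (c : galoisCohomology (W.torsionGaloisModule ((p ^ m : ℕ) : ℤ)) 1) :
    resH1Hom (subgroupIncl (κ.layerSubgroup 0)) (AddMonoidHom.id (geomPrimaryTorsion W p))
        (fun _ _ ↦ rfl) (galoisCohomology.map (primaryInclusion W p m) 1 c) ∈ W.selmerLayer κ 0 ↔
      c ∈ (W.kummerSelmerStructure ((p ^ m : ℕ) : ℤ)).selmerGroup := by
  have hconj : ∀ (σ : absoluteGaloisGroup K) (y : W.subgroupH1 p (κ.layerSubgroup 0)),
      W.conjH1 p (κ.layerSubgroup 0) σ y = y := fun σ y ↦ by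
    rw [W.conjH1_of_mem_holds p (κ.layerSubgroup 0) (mem_layerSubgroup_zero p κ σ), AddMonoidHom.id_apply]
  change _ ∈ W.selmerGroupOver p (κ.layerSubgroup 0) ↔ _
  rw [W.mem_selmerGroupOver_iff p, SelmerStructure.mem_selmerGroup_iff]
  simp only [hconj]
  constructor
  · rintro ⟨hfin, hinf⟩ v
    rcases v with w | v
    · have h := hinf w 1
      rw [mem_localKerOver_iff, localResOver_levelToLayerZero] at h
      exact mem_kummerLocalConditionAt_of_resH1Hom_map_eq_zero W p κ m w.Completion h
    · have h := hfin v 1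
      rw [mem_localKerOver_iff, localResOver_levelToLayerZero] at h
      exact mem_kummerLocalConditionAt_of_resH1Hom_map_eq_zero W p κ m (v.adicCompletion K) h
  · intro h
    refine ⟨fun v _ ↦ ?_, fun w _ ↦ ?_⟩
    · have hv : (galoisCohomology.res (W.torsionGaloisModule ((p ^ m : ℕ) : ℤ)) (v.adicCompletion K) 1 c) ∈
          W.kummerLocalConditionAt ((p ^ m : ℕ) : ℤ) (v.adicCompletion K) := h (Sum.inr v)
      rw [mem_localKerOver_iff, localResOver_levelToLayerZero]
      exact resH1Hom_map_eq_zero_of_mem_kummerLocalConditionAt W p κ m (v.adicCompletion K) hv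
    · have hw : (galoisCohomology.res (W.torsionGaloisModule ((p ^ m : ℕ) : ℤ)) w.Completion 1 c) ∈
          W.kummerLocalConditionAt ((p ^ m : ℕ) : ℤ) w.Completion := h (Sum.inl w)
      rw [mem_localKerOver_iff, localResOver_levelToLayerZero]
      exact resH1Hom_map_eq_zero_of_mem_kummerLocalConditionAt W p κ m w.Completion hw

end Classical

section StrictLocal

variable {K : Type u} [Field K] (W : WeierstrassCurve K) (p : ℕ) [hp : Fact p.Prime] (m : ℕ)
  (E : Type u) [Field E] [Algebra K E]

omit hp in
/-- `primaryPointsMap : E[p^∞](K̄) → E(Ē)[p^∞]` is injective (`pointsMap` is). [folklore] -/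
theorem primaryPointsMap_injective : Function.Injective (primaryPointsMap W E p) := by
  intro P Q h
  apply Subtype.ext
  apply pointsMapOfEmb_injective W (closureEmb (K := K) E)
  exact congrArg (fun R : AddCommGroup.primaryComponent (localPoints W E) p ↦ (R : localPoints W E)) h

/-- `primaryPointsMap : E[p^∞](K̄) → E(Ē)[p^∞]` is surjective for an elliptic curve in
characteristic `0`: the torsion of `E(Ē)` is algebraic (`torsionPointsEquiv`: `E[n](K̄) ≅ E(Ē)[n]`).
[cite: SilvermanAEC2009, Cor. III.6.4(b)] -/
theorem primaryPointsMap_surjective [CharZero K] [W.IsElliptic] :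
    Function.Surjective (primaryPointsMap W E p) := by
  intro a
  obtain ⟨k, hk⟩ := (AddCommGroup.mem_primaryComponent (G := localPoints W E) (p := p)).mp a.2
  have hne : ((p ^ k : ℕ) : ℤ) ≠ 0 := by exact_mod_cast pow_ne_zero k hp.out.ne_zero
  have ha : (a : localPoints W E) ∈ AddSubgroup.torsionBy (localPoints W E) ((p ^ k : ℕ) : ℤ) := by
    change ((p ^ k : ℕ) : ℤ) • (a : localPoints W E) = 0
    rw [natCast_zsmul]
    exact hk
  set T : geomTorsion W ((p ^ k : ℕ) : ℤ) :=
    (W.torsionPointsEquiv ((p ^ k : ℕ) : ℤ) (E := E) hne).symm ⟨a, ha⟩ with hT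
  refine ⟨⟨(T : geomPoints W), geomTorsion_pow_le_geomPrimaryTorsion W p k T.2⟩, Subtype.ext ?_⟩
  change pointsMap W E (T : geomPoints W) = (a : localPoints W E)
  rw [hT, pointsMap_torsionPointsEquiv_symm]

/-- **A class of `H¹(K, E[p^∞])` dying in `H¹(E, E(Ē)[p^∞])` (`selmerLocalKerPrimaryTorsion`, the
`p`-strict local kernel of the tree) dies in `H¹(E, E[p^∞]|_{Γ_E})` (`res_E = 0`)**: a principal
witness `a ∈ E(Ē)[p^∞]` lifts to `E[p^∞](K̄)` (`primaryPointsMap` bijective); then X11b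
`LocBridge.res_ofSMul_eq_zero_iff`. [cite: Skinner2020, §2.2] [cite: GreenbergLNM1716, §2 p. 63] -/
theorem res_primaryGaloisModule_eq_zero_of_mem_selmerLocalKerPrimaryTorsion [CharZero K]
    [W.IsElliptic] {x : W.galH1Primary p} (hx : x ∈ selmerLocalKerPrimaryTorsion W E p) :
    galoisCohomology.res (LocBridge.primaryGaloisModule W p) E 1 x = 0 := by
  obtain ⟨ψ, rfl⟩ := oneCocycleClass_surjective _ x
  have hker : oneCocycleClass _ ψ ∈ selmerLocalKerPrimaryTorsion W E p ↔
      ∃ a : AddCommGroup.primaryComponent (localPoints W E) p,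
        ∀ σ : absoluteGaloisGroup E, primaryPointsMap W E p (ψ.1 (resGal (K := K) E σ)) = σ • a - a := by
    unfold selmerLocalKerPrimaryTorsion
    exact oneCocycleClass_mem_resKer_iff _ _ _ ψ
  obtain ⟨a, ha⟩ := hker.mp hx
  obtain ⟨T, rfl⟩ := primaryPointsMap_surjective W p E a
  have hT : ∀ σ : absoluteGaloisGroup E, ψ.1 (resGal (K := K) E σ) = resGal (K := K) E σ • T - T :=
    fun σ ↦ primaryPointsMap_injective W p E (by rw [ha σ, map_sub, primaryPointsMap_smul])
  refine (LocBridge.res_ofSMul_eq_zero_iff (LocBridge.isOpen_stabilizer_geomPrimaryTorsion W p) E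
    (oneCocycleClass _ ψ)).mpr ((LocBridge.resSubgroup_oneCocycleClass_eq_zero_iff _ ψ).mpr ⟨T, ?_⟩)
  rintro g ⟨σ, rfl⟩
  exact hT σ

/-- **`Ψ_m c ∈ localKummerOverOfEmb W p (κ⁻¹(p⁰ℤ_p)) (closureEmb E) A` with `A` TORSION ⟹ `res_E c = 0`**
(for `E` elliptic, `E(Ē)[p^∞]^{Γ_E} = 0`): the Kummer condition cut out by torsion points is the
`p`-strict local condition `Ψ_m c ↦ (E[p^m] ↪ E[p^∞])_* c ∈ selmerLocalKerPrimaryTorsion` (p17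
`StrictSignedLayerZero.resH1Hom_subgroupIncl_mem_localKummerOverOfEmb_iff`), which is `res_E ((E[p^m] ↪
E[p^∞])_* c) = 0`, which is `res_E c = 0` (`res ∘ map = map ∘ res`, X11b
`map_primaryInclusion_restrictField_injective`). [cite: Kobayashi2003, §2 p. 4 (m = −1)]
[cite: Skinner2020, §2.2] -/
theorem res_eq_zero_of_levelToLayerZero_mem_localKummerOverOfEmb [CharZero K] [W.IsElliptic]
    (κ : ZpExtension K p)
    (hΓE : ∀ Q : W.geomPrimaryTorsion p, (∀ σ : absoluteGaloisGroup E,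
      GaloisRep.restrictField E (LocBridge.primaryGaloisModule W p) σ Q = Q) → Q = 0)
    (A : AddSubgroup (localPoints W E)) (hA : ∀ Q ∈ A, IsOfFinAddOrder Q)
    (c : galoisCohomology (W.torsionGaloisModule ((p ^ m : ℕ) : ℤ)) 1)
    (hc : resH1Hom (subgroupIncl (κ.layerSubgroup 0)) (AddMonoidHom.id (geomPrimaryTorsion W p))
        (fun _ _ ↦ rfl) (galoisCohomology.map (primaryInclusion W p m) 1 c) ∈
      localKummerOverOfEmb W p (κ.layerSubgroup 0) (closureEmb (K := K) E) A) :
    galoisCohomology.res (W.torsionGaloisModule ((p ^ m : ℕ) : ℤ)) E 1 c = 0 := by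
  have h1 : galoisCohomology.map (primaryInclusion W p m) 1 c ∈ selmerLocalKerPrimaryTorsion W E p :=
    (StrictSignedLayerZero.resH1Hom_subgroupIncl_mem_localKummerOverOfEmb_iff W p (κ.layerSubgroup 0)
      (mem_layerSubgroup_zero p κ) A hA _).mp hc
  have h2 := res_primaryGaloisModule_eq_zero_of_mem_selmerLocalKerPrimaryTorsion W p E h1
  rw [galoisCohomology.res_map_one] at h2
  apply map_primaryInclusion_restrictField_injective W p m E hΓE
  rw [h2, map_zero]

/-- **Conversely `res_E c = 0 ⟹ Ψ_m c ∈ localKummerOverOfEmb … A`** for every `A` (file 73 §4), so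
for `A` torsion: `Ψ_m c` satisfies the level-`0` STRICT-minus Kummer condition at `E` iff
`res_E c = 0`. [cite: Kobayashi2003, §2 p. 4 (m = −1) and Def. 2.1] -/
theorem levelToLayerZero_mem_localKummerOverOfEmb_iff_res_eq_zero [CharZero K] [W.IsElliptic]
    (κ : ZpExtension K p)
    (hΓE : ∀ Q : W.geomPrimaryTorsion p, (∀ σ : absoluteGaloisGroup E,
      GaloisRep.restrictField E (LocBridge.primaryGaloisModule W p) σ Q = Q) → Q = 0)
    (A : AddSubgroup (localPoints W E)) (hA : ∀ Q ∈ A, IsOfFinAddOrder Q)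
    (c : galoisCohomology (W.torsionGaloisModule ((p ^ m : ℕ) : ℤ)) 1) :
    resH1Hom (subgroupIncl (κ.layerSubgroup 0)) (AddMonoidHom.id (geomPrimaryTorsion W p))
        (fun _ _ ↦ rfl) (galoisCohomology.map (primaryInclusion W p m) 1 c) ∈
        localKummerOverOfEmb W p (κ.layerSubgroup 0) (closureEmb (K := K) E) A ↔
      galoisCohomology.res (W.torsionGaloisModule ((p ^ m : ℕ) : ℤ)) E 1 c = 0 :=
  ⟨res_eq_zero_of_levelToLayerZero_mem_localKummerOverOfEmb W p m E κ hΓE A hA c,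
    levelToLayerZero_mem_localKummerOverOfEmb_of_res_eq_zero W p m E κ A c⟩

end StrictLocal

section Strict

variable {K : Type u} [Field K] [NumberField K] (W : WeierstrassCurve K) [W.IsElliptic] (p : ℕ)
  [hp : Fact p.Prime] (κ : ZpExtension K p) (m : ℕ) (v₀ : HeightOneSpectrum (𝓞 K))
  (E : Type u) [Field E] [Algebra K E] [Algebra (v₀.adicCompletion K) E]
  [IsScalarTower K (v₀.adicCompletion K) E] [Algebra E (v₀.adicCompletion K)]
  [IsScalarTower K E (v₀.adicCompletion K)]

/-- **`Ψ_m c ∈ S₀ = Sel^{−,str}(E/K_0) ↔ (c ∈ H¹_𝓚 ∧ loc_{v₀} c = 0)`** for a model `E` of `K_{v₀}`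
(`K`-algebra maps both ways) with `E(Ē)[p^∞]^{Γ_E} = 0`: the bottom strict-minus local group is the
torsion of `E(E)` (`mem_strictSignedLocalPointsOfEmb_neg_one_zero_iff`), its Kummer condition on
`Ψ_m c` is `res_E c = 0` (§1), i.e. `loc_{v₀} c = 0` (file 73), and the classical part is `c ∈ H¹_𝓚`.
[cite: Kobayashi2003, §2 p. 4 (m = −1) and Def. 2.1 (p. 5)] [cite: Skinner2020, §2.2] -/
theorem levelToLayerZero_mem_strictSignedSelmerLayer_neg_one_zero_iff
    (hΓE : ∀ Q : W.geomPrimaryTorsion p, (∀ σ : absoluteGaloisGroup E,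
      GaloisRep.restrictField E (LocBridge.primaryGaloisModule W p) σ Q = Q) → Q = 0)
    (c : galoisCohomology (W.torsionGaloisModule ((p ^ m : ℕ) : ℤ)) 1) :
    resH1Hom (subgroupIncl (κ.layerSubgroup 0)) (AddMonoidHom.id (geomPrimaryTorsion W p))
        (fun _ _ ↦ rfl) (galoisCohomology.map (primaryInclusion W p m) 1 c) ∈
        strictSignedSelmerLayer W κ E (-1) 0 ↔
      c ∈ (W.kummerSelmerStructure ((p ^ m : ℕ) : ℤ)).selmerGroup ∧
        galoisCohomology.localization (W.torsionGaloisModule ((p ^ m : ℕ) : ℤ)) (Sum.inr v₀) 1 c = 0 := by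
  have hconj : ∀ (σ : absoluteGaloisGroup K) (y : W.subgroupH1 p (κ.layerSubgroup 0)),
      W.conjH1 p (κ.layerSubgroup 0) σ y = y := fun σ y ↦ by
    rw [W.conjH1_of_mem_holds p (κ.layerSubgroup 0) (mem_layerSubgroup_zero p κ σ), AddMonoidHom.id_apply]
  have hA : ∀ Q ∈ strictSignedLocalPoints κ E W (-1) 0, IsOfFinAddOrder Q := fun Q hQ ↦ by
    rw [← AddCommGroup.mem_torsion]
    exact ((mem_strictSignedLocalPointsOfEmb_neg_one_zero_iff κ _ W Q).mp hQ).2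
  rw [mem_strictSignedSelmerLayer_iff, levelToLayerZero_mem_selmerLayer_zero_iff]
  simp only [hconj, forall_const]
  rw [levelToLayerZero_mem_localKummerOverOfEmb_iff_res_eq_zero W p m E κ hΓE _ hA]
  exact and_congr Iff.rfl ⟨localization_eq_zero_of_res_eq_zero W _ v₀ E c,
    res_eq_zero_of_localization_eq_zero W _ v₀ E c⟩

/-- The same as a Selmer structure: **`Ψ_m c ∈ S₀ ↔ c ∈ H¹_{𝓚[v₀ ↦ 0]}(K, E[p^m])`** (Kummer at every
place, ZERO at `v₀` — the structure `𝓕 = 𝓚[v₀ ↦ ⊥]` of the count (C), files 63, 68–70).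
[cite: Kobayashi2003, §2 p. 4 (m = −1) and Def. 2.1 (p. 5)] -/
theorem mem_selmerGroup_update_bot_iff_levelToLayerZero_mem_strictSignedSelmerLayer
    (hΓE : ∀ Q : W.geomPrimaryTorsion p, (∀ σ : absoluteGaloisGroup E,
      GaloisRep.restrictField E (LocBridge.primaryGaloisModule W p) σ Q = Q) → Q = 0)
    (c : galoisCohomology (W.torsionGaloisModule ((p ^ m : ℕ) : ℤ)) 1) :
    c ∈ SelmerStructure.selmerGroup
        (Function.update (W.kummerSelmerStructure ((p ^ m : ℕ) : ℤ)) (Sum.inr v₀) ⊥) ↔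
      resH1Hom (subgroupIncl (κ.layerSubgroup 0)) (AddMonoidHom.id (geomPrimaryTorsion W p))
        (fun _ _ ↦ rfl) (galoisCohomology.map (primaryInclusion W p m) 1 c) ∈
        strictSignedSelmerLayer W κ E (-1) 0 := by
  rw [levelToLayerZero_mem_strictSignedSelmerLayer_neg_one_zero_iff W p κ m v₀ E hΓE,
    show Function.update (W.kummerSelmerStructure ((p ^ m : ℕ) : ℤ)) (Sum.inr v₀) ⊥ =
      Function.update (W.kummerSelmerStructure ((p ^ m : ℕ) : ℤ)) (Sum.inr v₀)
        (W.kummerSelmerStructure ((p ^ m : ℕ) : ℤ) (Sum.inr v₀) ⊓ ⊥) by rw [inf_bot_eq],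
    mem_selmerGroup_update_inf_iff, AddSubgroup.mem_bot]

end Strict

section Loc

variable {K : Type u} [Field K] [NumberField K] (W : WeierstrassCurve K) (p : ℕ)
  [hp : Fact p.Prime] (κ : ZpExtension K p) (m : ℕ) (v₀ : HeightOneSpectrum (𝓞 K))
  (E : Type u) [Field E] [Algebra K E] [Algebra (v₀.adicCompletion K) E]
  [IsScalarTower K (v₀.adicCompletion K) E]

/-- **The signed condition at `E` is LOCAL at `v₀`.** Let `A₀ ≤ H¹(K_0, E[p^∞])` be arbitrary,
`Σ = (⨅_σ conj_σ⁻¹ localKummerOverOfEmb W p (ker κ) (closureEmb E) A) ∘ h_0` the "signed part" (any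
`A ≤ E(Ē)`), and `L = loc_{v₀}(Ψ_m⁻¹(A₀ ⊓ Σ)) ≤ H¹(K_{v₀}, E[p^m])`. For `c` with `Ψ_m c ∈ A₀`:
`loc_{v₀} c ∈ L ↔ Ψ_m c ∈ Σ` — if `loc_{v₀} c = loc_{v₀} c'` with `Ψ_m c' ∈ A₀ ⊓ Σ` then
`loc_{v₀}(c − c') = 0`, so `res_E (c − c') = 0` (file 73 §3, along `K_{v₀} → E`) and `Ψ_m (c − c') ∈ Σ`
(file 73 §4). [cite: Kobayashi2003, Def. 2.1 (p. 5) and §9] [cite: GreenbergLNM1716, §3 pp. 85–86] -/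
theorem localization_mem_map_iff_levelToLayerZero_mem (A₀ : AddSubgroup (W.subgroupH1 p (κ.layerSubgroup 0)))
    (A : AddSubgroup (localPoints W E)) (c : galoisCohomology (W.torsionGaloisModule ((p ^ m : ℕ) : ℤ)) 1)
    (hc : resH1Hom (subgroupIncl (κ.layerSubgroup 0)) (AddMonoidHom.id (geomPrimaryTorsion W p))
        (fun _ _ ↦ rfl) (galoisCohomology.map (primaryInclusion W p m) 1 c) ∈ A₀) :
    galoisCohomology.localization (W.torsionGaloisModule ((p ^ m : ℕ) : ℤ)) (Sum.inr v₀) 1 c ∈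
        ((A₀ ⊓ (⨅ σ : absoluteGaloisGroup K,
            (localKummerOverOfEmb W p κ.kerSubgroup (closureEmb (K := K) E) A).comap
              (W.conjH1 p κ.kerSubgroup σ)).comap (W.layerToInfty κ 0)).comap
          ((resH1Hom (subgroupIncl (κ.layerSubgroup 0)) (AddMonoidHom.id (geomPrimaryTorsion W p))
            (fun _ _ ↦ rfl)).comp (galoisCohomology.map (primaryInclusion W p m) 1))).map
          (galoisCohomology.localization (W.torsionGaloisModule ((p ^ m : ℕ) : ℤ)) (Sum.inr v₀) 1) ↔
      resH1Hom (subgroupIncl (κ.layerSubgroup 0)) (AddMonoidHom.id (geomPrimaryTorsion W p))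
        (fun _ _ ↦ rfl) (galoisCohomology.map (primaryInclusion W p m) 1 c) ∈
        (⨅ σ : absoluteGaloisGroup K,
            (localKummerOverOfEmb W p κ.kerSubgroup (closureEmb (K := K) E) A).comap
              (W.conjH1 p κ.kerSubgroup σ)).comap (W.layerToInfty κ 0) := by
  set Ψ := (resH1Hom (subgroupIncl (κ.layerSubgroup 0)) (AddMonoidHom.id (geomPrimaryTorsion W p))
    (fun _ _ ↦ rfl)).comp (galoisCohomology.map (primaryInclusion W p m) 1) with hΨ
  set Sig := (⨅ σ : absoluteGaloisGroup K,
    (localKummerOverOfEmb W p κ.kerSubgroup (closureEmb (K := K) E) A).comap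
      (W.conjH1 p κ.kerSubgroup σ)).comap (W.layerToInfty κ 0) with hSig
  have hc' : Ψ c ∈ A₀ := hc
  change _ ↔ Ψ c ∈ Sig
  constructor
  · rintro ⟨c', hc'mem, hloc⟩
    have hc'mem : c' ∈ (A₀ ⊓ Sig).comap Ψ := hc'mem
    rw [AddSubgroup.mem_comap, AddSubgroup.mem_inf] at hc'mem
    have hd : galoisCohomology.localization (W.torsionGaloisModule ((p ^ m : ℕ) : ℤ)) (Sum.inr v₀) 1
        (c - c') = 0 := by rw [map_sub, hloc, sub_self]
    have hres := res_eq_zero_of_localization_eq_zero W ((p ^ m : ℕ) : ℤ) v₀ E (c - c') hd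
    have hdSig : Ψ (c - c') ∈ Sig :=
      levelToLayerZero_mem_comap_iInf_localKummerOverOfEmb_of_res_eq_zero W p m E κ A (c - c') hres
    have e : Ψ c = Ψ c' + Ψ (c - c') := by rw [map_sub, add_sub_cancel]
    rw [e]
    exact Sig.add_mem hc'mem.2 hdSig
  · intro hS
    exact ⟨c, AddSubgroup.mem_comap.mpr (AddSubgroup.mem_inf.mpr ⟨hc', hS⟩), rfl⟩

/-- **`Ψ_m c ∈ A₀ ↔ c ∈ H¹_{𝓣[v₀ ↦ 𝓣_{v₀} ⊓ L]}`** for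
`A₀ = (Sel_{p^∞}(E/K_∞) ⊓ ⨅_σ conj_σ⁻¹ localKummerOverOfEmb W p (ker κ) (closureEmb E) A) ∘ h_0` — the
shape of `Sel^{loc,∞}` of files 42–59 (there `A = ⨆_n E^{ε,str}(K_n·E)`) — with `𝓣` a tower
structure at level `m` (`𝓣_v = θ_v⁻¹(𝒦_{v,0})` at finite `v`, `𝓣_w = 𝓚_w` at infinite `w`) and
`L = loc_{v₀}(Ψ_m⁻¹ A₀)`: `A₀` IS (along `Ψ_m`) the Selmer group of a Selmer structure on `E[p^m]`
(file 72 §2 + the locality above). [cite: Kobayashi2003, Def. 2.1 (p. 5) and §9]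
[cite: GreenbergLNM1716, §3 pp. 85–86] -/
theorem mem_selmerGroup_update_iff_levelToLayerZero_mem_localPreimage
    (𝓣 : SelmerStructure (W.torsionGaloisModule ((p ^ m : ℕ) : ℤ)))
    (h𝓣fin : ∀ v : HeightOneSpectrum (𝓞 K), 𝓣 (Sum.inr v) =
      (W.localTowerKer κ (v.adicCompletion K) 0).comap
        ((resH1Hom (subgroupIncl (localSubgroup (κ.layerSubgroup 0) (v.adicCompletion K)))
          (AddMonoidHom.id (localPoints W (v.adicCompletion K))) (fun _ _ ↦ rfl)).comp
          (galoisCohomology.map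
            (W.torsionPointsMapIntertwining ((p ^ m : ℕ) : ℤ) (v.adicCompletion K)) 1)))
    (h𝓣inf : ∀ w : InfinitePlace K, 𝓣 (Sum.inl w) = W.kummerSelmerStructure ((p ^ m : ℕ) : ℤ) (Sum.inl w))
    (A : AddSubgroup (localPoints W E)) (c : galoisCohomology (W.torsionGaloisModule ((p ^ m : ℕ) : ℤ)) 1) :
    c ∈ SelmerStructure.selmerGroup (Function.update 𝓣 (Sum.inr v₀) (𝓣 (Sum.inr v₀) ⊓
        ((((W.selmerInfty κ ⊓ ⨅ σ : absoluteGaloisGroup K,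
            (localKummerOverOfEmb W p κ.kerSubgroup (closureEmb (K := K) E) A).comap
              (W.conjH1 p κ.kerSubgroup σ)).comap (W.layerToInfty κ 0)).comap
          ((resH1Hom (subgroupIncl (κ.layerSubgroup 0)) (AddMonoidHom.id (geomPrimaryTorsion W p))
            (fun _ _ ↦ rfl)).comp (galoisCohomology.map (primaryInclusion W p m) 1))).map
          (galoisCohomology.localization (W.torsionGaloisModule ((p ^ m : ℕ) : ℤ)) (Sum.inr v₀) 1)))) ↔
      resH1Hom (subgroupIncl (κ.layerSubgroup 0)) (AddMonoidHom.id (geomPrimaryTorsion W p))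
        (fun _ _ ↦ rfl) (galoisCohomology.map (primaryInclusion W p m) 1 c) ∈
        (W.selmerInfty κ ⊓ ⨅ σ : absoluteGaloisGroup K,
            (localKummerOverOfEmb W p κ.kerSubgroup (closureEmb (K := K) E) A).comap
              (W.conjH1 p κ.kerSubgroup σ)).comap (W.layerToInfty κ 0) := by
  rw [AddSubgroup.comap_inf]
  exact mem_selmerGroup_update_inf_iff_levelToLayerZero_mem_inf W p κ m 𝓣 (W.selmerInftyPreimage κ 0)
    (mem_selmerGroup_iff_levelToLayerZero_mem_selmerInftyPreimage W p κ m 𝓣 h𝓣fin h𝓣inf)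
    (Sum.inr v₀) _ _ (fun c hc ↦ localization_mem_map_iff_levelToLayerZero_mem W p κ m v₀ E
      (W.selmerInftyPreimage κ 0) A c hc) c

end Loc

section Index

variable {K : Type u} [Field K] [NumberField K] (W : WeierstrassCurve K) [W.IsElliptic] (p : ℕ)
  [hp : Fact p.Prime] (κ : ZpExtension K p) (m : ℕ) (v₀ : HeightOneSpectrum (𝓞 K))
  (E : Type u) [Field E] [Algebra K E] [Algebra (v₀.adicCompletion K) E]
  [IsScalarTower K (v₀.adicCompletion K) E] [Algebra E (v₀.adicCompletion K)]
  [IsScalarTower K E (v₀.adicCompletion K)]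

/-- **THE BRIDGE: `[H¹_𝓖(K, E[p^m]) : H¹_{𝓚[v₀ ↦ 0]}(K, E[p^m])] = [A₀ : S₀]`** with
`𝓖 = 𝓣[v₀ ↦ 𝓣_{v₀} ⊓ loc_{v₀}(Ψ_m⁻¹ A₀)]` (`𝓣` a tower structure at level `m`), `A₀ = Sel^{loc,∞}` built
on `A = ⨆_n E^{−,str}(K_n·E)` (files 42–59) and `S₀ = Sel^{−,str}(E/K_0)`, provided `p^m A₀ = 0`
(`#A₀ = p^{ord_p f(0)}`, file 59, and `m ≥ ord_p f(0)`), `E(K̄)` divisible, `E(Ē)[p^∞]^{Γ_E} = 0` and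
`E ≅ K_{v₀}` as `K`-algebras (maps both ways): the relative indices agree (file 72 `relIndex` transfer,
NO injectivity of `Ψ_m` needed). With `S₀ ≤ A₀` (files 42/47) the right side is `#(A₀ ⧸ S₀)`, the
quantity of the (C3_η) derivation; the left side is what the count (C) at finite level computes
(files 63, 68–70) once `𝓖_{v₀} = p^t·C`, `𝓖_ℓ ⊇ 𝓚_ℓ` are identified (B3 / B4); nothing is booked.
[cite: GreenbergLNM1716, §3 pp. 85–90] [cite: Kobayashi2003, Def. 2.1 (p. 5), §9 Thm. 9.3 (p. 26)] -/
theorem relIndex_selmerGroup_update_eq_relIndex_strictSignedSelmerLayer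
    (hdiv : W.zsmul_geomPoints_surjective)
    (hΓE : ∀ Q : W.geomPrimaryTorsion p, (∀ σ : absoluteGaloisGroup E,
      GaloisRep.restrictField E (LocBridge.primaryGaloisModule W p) σ Q = Q) → Q = 0)
    (𝓣 : SelmerStructure (W.torsionGaloisModule ((p ^ m : ℕ) : ℤ)))
    (h𝓣fin : ∀ v : HeightOneSpectrum (𝓞 K), 𝓣 (Sum.inr v) =
      (W.localTowerKer κ (v.adicCompletion K) 0).comap
        ((resH1Hom (subgroupIncl (localSubgroup (κ.layerSubgroup 0) (v.adicCompletion K)))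
          (AddMonoidHom.id (localPoints W (v.adicCompletion K))) (fun _ _ ↦ rfl)).comp
          (galoisCohomology.map
            (W.torsionPointsMapIntertwining ((p ^ m : ℕ) : ℤ) (v.adicCompletion K)) 1)))
    (h𝓣inf : ∀ w : InfinitePlace K, 𝓣 (Sum.inl w) = W.kummerSelmerStructure ((p ^ m : ℕ) : ℤ) (Sum.inl w))
    (hA₀ : ∀ z ∈ (W.selmerInfty κ ⊓ ⨅ σ : absoluteGaloisGroup K,
        (localKummerOverOfEmb W p κ.kerSubgroup (closureEmb (K := K) E)
          (⨆ n, strictSignedLocalPoints κ E W (-1) n)).comap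
            (W.conjH1 p κ.kerSubgroup σ)).comap (W.layerToInfty κ 0), p ^ m • z = 0) :
    (SelmerStructure.selmerGroup
        (Function.update (W.kummerSelmerStructure ((p ^ m : ℕ) : ℤ)) (Sum.inr v₀) ⊥)).relIndex
      (SelmerStructure.selmerGroup (Function.update 𝓣 (Sum.inr v₀) (𝓣 (Sum.inr v₀) ⊓
        ((((W.selmerInfty κ ⊓ ⨅ σ : absoluteGaloisGroup K,
            (localKummerOverOfEmb W p κ.kerSubgroup (closureEmb (K := K) E)
              (⨆ n, strictSignedLocalPoints κ E W (-1) n)).comap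
                (W.conjH1 p κ.kerSubgroup σ)).comap (W.layerToInfty κ 0)).comap
          ((resH1Hom (subgroupIncl (κ.layerSubgroup 0)) (AddMonoidHom.id (geomPrimaryTorsion W p))
            (fun _ _ ↦ rfl)).comp (galoisCohomology.map (primaryInclusion W p m) 1))).map
          (galoisCohomology.localization (W.torsionGaloisModule ((p ^ m : ℕ) : ℤ)) (Sum.inr v₀) 1))))) =
      (strictSignedSelmerLayer W κ E (-1) 0).relIndex
        ((W.selmerInfty κ ⊓ ⨅ σ : absoluteGaloisGroup K,
          (localKummerOverOfEmb W p κ.kerSubgroup (closureEmb (K := K) E)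
            (⨆ n, strictSignedLocalPoints κ E W (-1) n)).comap
              (W.conjH1 p κ.kerSubgroup σ)).comap (W.layerToInfty κ 0)) :=
  relIndex_selmerGroup_eq_of_iff W p κ m hdiv _ _ _ _ hA₀
    (fun c ↦ mem_selmerGroup_update_bot_iff_levelToLayerZero_mem_strictSignedSelmerLayer W p κ m v₀ E
      hΓE c)
    (fun c ↦ mem_selmerGroup_update_iff_levelToLayerZero_mem_localPreimage W p κ m v₀ E 𝓣 h𝓣fin
      h𝓣inf _ c)

end Index

end Summit.BirchSwinnertonDyer.Rank1Residual.Additive.LevelBridge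

end
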